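import Summits.HodgeConjecture.HodgeConjecture.Theses.LinearSystemTorelli

/-!
# Route LinearSystemTorelli — `SupportedOfTranscendentalOrSupported` (support item stmt-HodgeConjecture-2411)

The glue `TranscendentalOrSupported → MiddleDivisorSupport` of route `LinearSystemTorelli`:
the thesis X (every sub-Hodge structure of `H^{2p}(X)` spanned by rational classes and without
`(2p,0)`-part lies in `N¹H^{2p} = supportedClasses X (2p) 1`) implies that every rational class of
type `(p,p)` in the middle degree of a smooth projective `2p`-fold (`p ≥ 1`) is supported on a
divisor.  Proof: given `c` rational with `A^* c ∈ H^{p,p}` for a Hodge model `A`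
(`IsOfHodgeType`), apply X with `r = 1`, `b 0 = c` and that `A`: the line `W = ℂ · A^* c ⊆ H^{p,p}`
equals `⨆_{p'+q'=2p} W ⊓ H^{p',q'}` through its `(p,p)` term, and `W ⊓ H^{2p,0} = 0` because the
pieces `H^{p,p}` and `H^{2p,0}` of the Hodge decomposition of `A` are independent
(field `HodgeModel.isInternal_hodgePQ`, transported along the de Rham comparison) and
`(p,p) ≠ (2p,0)` for `p ≥ 1`.  Pure tree lemmas; no named facts.  Self-contained: imports only this
route's thesis file.
-/

noncomputable section

namespace Summit.HodgeConjecture.HodgeConjecture.Theorems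

open Literature.AlgebraicGeometry.HodgeTheory Literature.AlgebraicGeometry.Motives

/-- **Distinct Hodge pieces of one degree are disjoint.** In a Hodge model `A` of `X`, for
`p + q = k = p' + q'` with `(p, q) ≠ (p', q')`, `H^{p,q} ∩ H^{p',q'} = 0` in `Hᵏ(X^an; ℂ)`: the
pieces of the Hodge decomposition of the model are independent (field `isInternal_hodgePQ`,
Voisin I Thm. 6.18 / Cor. 6.14 "a class of two different types is zero"), and independence is
transported along the de Rham comparison `A.deRham`. Helper for
`linearSystemTorelli_supportedOfTranscendentalOrSupported_proof`.
[cite: VoisinHodgeI2002, Thm. 6.18 and Cor. 6.14] -/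
theorem linearSystemTorelli_disjoint_hodgePQ {n : ℕ} {X : SchemeOver ℂ} (A : HodgeModel n X)
    {k p q p' q' : ℕ} (hpq : p + q = k) (hpq' : p' + q' = k) (hne : (p, q) ≠ (p', q')) :
    Disjoint (A.hodgePQ k p q) (A.hodgePQ k p' q') := by
  -- the de Rham side: the pieces `T j`, independent by the Hodge decomposition of the model
  set T : ↥(Finset.HasAntidiagonal.antidiagonal k) →
      Submodule ℂ (Literature.NumberTheory.Transcendental.complexDeRhamCohomology A.model A.carrier k) :=
    fun j ↦ Literature.NumberTheory.Transcendental.hodgePQ A.model A.carrier k j.1.1 j.1.2 with hT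
  have hind : iSupIndep T := (A.isInternal_hodgePQ k).submodule_iSupIndep
  let i₀ : ↥(Finset.HasAntidiagonal.antidiagonal k) :=
    ⟨(p, q), Finset.HasAntidiagonal.mem_antidiagonal.2 hpq⟩
  let i₁ : ↥(Finset.HasAntidiagonal.antidiagonal k) :=
    ⟨(p', q'), Finset.HasAntidiagonal.mem_antidiagonal.2 hpq'⟩
  have hne' : i₀ ≠ i₁ := fun h ↦ hne (congrArg Subtype.val h)
  have hdisj : Disjoint (T i₀) (T i₁) := hind.pairwiseDisjoint hne'
  -- transport along the (injective) de Rham comparison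
  rw [Submodule.disjoint_def]
  intro x hx hx'
  obtain ⟨w, hw, rfl⟩ := Submodule.mem_map.1 hx
  obtain ⟨w', hw', hww'⟩ := Submodule.mem_map.1 hx'
  obtain rfl : w' = w := (A.deRham A.carrier k).injective hww'
  have hw₀ : w' ∈ T i₀ := hw
  have hw₁ : w' ∈ T i₁ := hw'
  have hw0 : w' = 0 := (Submodule.disjoint_def.1 hdisj) w' hw₀ hw₁
  rw [hw0, map_zero]

/-- **Item stmt-HodgeConjecture-2411 (`SupportedOfTranscendentalOrSupported`)**: the thesis X of
route `LinearSystemTorelli` (`TranscendentalOrSupported`: GHC in coniveau 1 for the middle cohomology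
of even-dimensional smooth projective varieties, sub-Hodge form) implies `MiddleDivisorSupport`
(every rational `(p,p)` class in `H^{2p}` of a smooth projective `2p`-fold, `p ≥ 1`, lies in
`supportedClasses X (2p) 1`).  Given `c` rational with `A^* c ∈ H^{p,p}`, apply X to the
one-element family `b 0 = c` and the model `A`: the pulled-back span `W ⊆ H^{p,p}` is the supremum
of its intersections with the `H^{p',q'}` (through the `(p,p)` term), and meets `H^{2p,0}` trivially
(`linearSystemTorelli_disjoint_hodgePQ`, `(p,p) ≠ (2p,0)` as `p ≥ 1`).  The type is literally the
route decl `Summit.HodgeConjecture.HodgeConjecture.Theses.LinearSystemTorelli.SupportedOfTranscendentalOrSupported`.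
[cite: VoisinHodgeI2002, §7.1.1 and Cor. 6.14] [cite: GrothendieckTopology1969, p. 300] -/
theorem linearSystemTorelli_supportedOfTranscendentalOrSupported_proof :
    Summit.HodgeConjecture.HodgeConjecture.Theses.LinearSystemTorelli.SupportedOfTranscendentalOrSupported := by
  unfold Summit.HodgeConjecture.HodgeConjecture.Theses.LinearSystemTorelli.SupportedOfTranscendentalOrSupported
  intro hT p X hp hX c hc hh
  obtain ⟨A, hA⟩ := hh
  -- the pulled-back span of the one-element family `b _ = c` lies in `H^{p,p}`
  have hW : (Submodule.span ℂ (Set.range fun _ : Fin 1 ↦ c)).map (A.pullback (2 * p)).hom ≤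
      A.hodgePQ (2 * p) p p := by
    rw [Submodule.map_span_le]
    rintro _ ⟨j, rfl⟩
    exact hA
  refine hT hp hX A 1 (fun _ ↦ c) (fun _ ↦ hc) ?_ ?_ 0
  · -- sub-Hodge: `W = ⨆_{p'+q'=2p} W ⊓ H^{p',q'}` through the `(p,p)` term
    refine le_antisymm ?_ (iSup_le fun _ ↦ iSup_le fun _ ↦ iSup_le fun _ ↦ inf_le_left)
    exact le_iSup_of_le p (le_iSup_of_le p (le_iSup_of_le (two_mul p).symm (le_inf le_rfl hW)))
  · -- no `(2p,0)`-part: `H^{p,p} ∩ H^{2p,0} = 0` for `p ≥ 1`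
    have hne : (p, p) ≠ (2 * p, 0) := by
      simp only [ne_eq, Prod.mk.injEq, not_and]
      omega
    exact disjoint_iff.1
      ((linearSystemTorelli_disjoint_hodgePQ A (two_mul p).symm (by omega) hne).mono_left hW)

end Summit.HodgeConjecture.HodgeConjecture.Theorems

end
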